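import Summits.CriticalPhenomena.PercolationContinuityZ3.Theorems.PercNearOneGluingNoHeavyLowerTailSahiC4CubeFourAllOrders
import Summits.CriticalPhenomena.PercolationContinuityZ3.Theorems.SahiMasterFamilyWidthCollapse
import HarnessLib

/-!
# `NoHeavyLowerTail` (stmt-CriticalPhenomena-4575) — Sahi's conjecture at ALL ORDERS on `{0,1}^4` ⟸ `E₅, E₆ ≥ 0` on the RESIDUAL (non-absorbing) quintuples and sextuples

Support file, seat `prim-l12-p5` (gen 4), `--supports stmt-CriticalPhenomena-4575`, COMPUTATIONAL (through the kernel `C₃`, `C₄` on four coins).  No definitions,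
no named facts, no sorries.  Combines this lane's `C₄` on the 4-cube (`sahiPositive_bernoulliWeight_four_fin_four`), Theorem G′
(`sahiE_nonneg_of_small_of_absorbing`) and seat `prim-masterthm-p4`'s width collapse (`sahiPositive_all_of_width`, `finset_width_le_choose`:
Sperner ⇒ on `2⁴` orders `≤ 6` suffice).

* `set_fin_four_width` — any `C(4,2) + 1 = 7` subsets of `Fin 4` contain a comparable pair (Sperner, transported from `Finset (Fin 4)` to `Set (Fin 4)`).
* `sahiPositive_bernoulliWeight_all_fin_four_of_five_six` — for a product weight on `2^{Fin 4}`, Sahi positivity of orders `5` and `6` implies EVERY order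
  (orders `≤ 4` are theorems: FKG, the kernel `C₃`, this lane's `C₄`).
* `sahiPositive_bernoulliWeight_five_fin_four_of_residual`, `…six…` — order `5` (resp. `6`, given order `5`) follows from `E₅ ≥ 0` (resp. `E₆ ≥ 0`) on the
  NON-ABSORBING quintuples (sextuples) of increasing events only — families in which no member contains the intersection of the others; absorbing families are
  settled by Theorem G′ with the lower orders.  Exhaustive enumeration (seat `code/g4/nonabs_max_k4.py`, `residual_families_k4.json`): 31 968 such quintuples and
  4 096 sextuples of up-sets of `2⁴` (the sextuples are `E_j = ↑({2-subsets} ∖ {x_j}) ∪ S_j`, `S_j ⊆` the two singletons outside `x_j`); exact values at four test weights: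
  `E₅ ≥ 0.118`, `E₆ ≥ 0.448`; their level-5/6 tensor-Bernstein coefficients are `≥ 0` on samples (`comb_residual_k4.py`).
* **`sahiPositive_bernoulliWeight_all_fin_four_of_residual`** — hence: `E₅ ≥ 0` on the residual quintuples and `E₆ ≥ 0` on the residual sextuples imply Sahi's
  conjecture at EVERY order for EVERY product measure on `{0,1}^4`.  (The two hypotheses are finite certificate problems of five- or six-copy type, cf.
  `SahiC4Cube.checkQuadW`; nothing here asserts them.)
-/

namespace Summit.CriticalPhenomena.PercolationContinuityZ3.Theorems

namespace SahiHereditaryMeetAbsorption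

open Finset Literature.Combinatorics.Sahi2008 SahiMomentExpansion SahiDefectExpansion
open Literature.Probability.Percolation.DecisionTree (ind ind_of_mem ind_of_not_mem ind_nonneg)

/-- **Width of `Set (Fin 4)`**: among any `C(4,2) + 1` subsets of `Fin 4` two are comparable (Sperner; `finset_width_le_choose` transported). [this file] -/
theorem set_fin_four_width (y : Fin ((Fintype.card (Fin 4)).choose (Fintype.card (Fin 4) / 2) + 1) → Set (Fin 4)) :
    ∃ i j, i ≠ j ∧ y i ≤ y j := by
  classical
  obtain ⟨i, j, hij, hle⟩ := SahiWidthCollapse.finset_width_le_choose (fun i => (y i).toFinset)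
  refine ⟨i, j, hij, fun a ha => ?_⟩
  have h := hle (Set.mem_toFinset.mpr ha)
  exact Set.mem_toFinset.mp h

/-- **On `2^{Fin 4}`, orders `5` and `6` give every order** (product weight; orders `≤ 4` are the kernel theorems). [this file] -/
theorem sahiPositive_bernoulliWeight_all_fin_four_of_five_six (p : Fin 4 → unitInterval)
    (h5 : SahiPositive (bernoulliWeight p) 5) (h6 : SahiPositive (bernoulliWeight p) 6) : ∀ n, SahiPositive (bernoulliWeight p) n := by
  have hμ0 := (isFKGMeasure_bernoulliWeight p).nonneg
  have hμ1 := (isFKGMeasure_bernoulliWeight p).sum_eq_one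
  refine SahiWidthCollapse.sahiPositive_all_of_width (bernoulliWeight p) hμ0 hμ1 set_fin_four_width fun n hn => ?_
  have hmax : max ((Fintype.card (Fin 4)).choose (Fintype.card (Fin 4) / 2)) 2 = 6 := by
    simp only [Fintype.card_fin]; decide
  rw [hmax] at hn
  rcases (show n ≤ 4 ∨ n = 5 ∨ n = 6 by omega) with h | rfl | rfl
  · exact (sahiPositive_bernoulliWeight_four_fin_four p).anti hμ0 hμ1 h
  · exact h5
  · exact h6

/-- The indicator families of the layer cake are the event indicators (plumbing). [folklore] -/
theorem setInd_eq_ind_coe {m : ℕ} (U : Fin m → Finset (Set (Fin 4))) :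
    (fun i => setInd (U i)) = fun i => ind ((U i : Finset (Set (Fin 4))) : Set (Set (Fin 4))) := by
  funext i ω
  simp [setInd_apply, ind]

/-- **One order from the residual families** (generic step): if the product weight is Sahi-positive of order `k + 1` (`k ≥ 1`... here `k + 1 ≥ 2`) and `E_{k+2} ≥ 0`
for every NON-ABSORBING family of `k + 2` increasing events (no member contains the intersection of the others), then it is Sahi-positive of order `k + 2`
(absorbing families: Theorem G′ with the lower orders). [this file] -/
theorem sahiPositive_bernoulliWeight_succ_fin_four_of_residual (p : Fin 4 → unitInterval) (k : ℕ)
    (hk : SahiPositive (bernoulliWeight p) (k + 1))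
    (hres : ∀ A : Fin (k + 2) → Set (Set (Fin 4)), (∀ i, IsUpperSet (A i)) →
      (∀ q : Fin (k + 2), ∃ ω, (∀ i, i ≠ q → ω ∈ A i) ∧ ω ∉ A q) →
      0 ≤ sahiE (bernoulliWeight p) (k + 2) (fun i => ind (A i))) :
    SahiPositive (bernoulliWeight p) (k + 2) := by
  classical
  have hμ0 := (isFKGMeasure_bernoulliWeight p).nonneg
  have hμ1 := (isFKGMeasure_bernoulliWeight p).sum_eq_one
  rw [sahiPositive_iff_indicators]
  intro U hU
  rw [setInd_eq_ind_coe]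
  have hA : ∀ i, IsUpperSet ((U i : Finset (Set (Fin 4))) : Set (Set (Fin 4))) := hU
  by_cases habs : ∃ q : Fin (k + 2), ∀ ω, (∀ i, i ≠ q → ω ∈ ((U i : Finset (Set (Fin 4))) : Set (Set (Fin 4)))) →
      ω ∈ ((U q : Finset (Set (Fin 4))) : Set (Set (Fin 4)))
  · -- absorbing: Theorem G′ at threshold k + 1
    refine sahiE_nonneg_of_small_of_absorbing hμ0 hμ1 (k := k + 1) (by omega) (k + 2) _
      (fun i ω => ind_nonneg _ _) (fun i ω => ?_) ?_ ?_
    · by_cases h : ω ∈ ((U i : Finset (Set (Fin 4))) : Set (Set (Fin 4)))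
      · rw [ind_of_mem h]
      · rw [ind_of_not_mem h]; exact zero_le_one
    · intro S _ hSk
      exact (hk.anti hμ0 hμ1 hSk) _ (fun j x => ind_nonneg _ _) (fun j => monotone_ind_of_isUpperSet (hA _))
    · intro S hS
      have hle := Finset.card_le_univ S
      rw [Fintype.card_fin] at hle
      have hSu : S = univ := Finset.eq_univ_of_card S (by rw [Fintype.card_fin]; omega)
      subst hSu
      obtain ⟨q, hq⟩ := habs
      exact exists_absorber_ind _ univ ⟨q, mem_univ _, fun ω hω => hq ω fun i hi => hω i (Finset.mem_erase.mpr ⟨hi, mem_univ _⟩)⟩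
  · -- non-absorbing: the residual hypothesis
    refine hres _ hA fun q => ?_
    by_contra hq
    apply habs
    refine ⟨q, fun ω hω => ?_⟩
    by_contra hω'
    exact hq ⟨ω, hω, hω'⟩

/-- **Sahi's conjecture at ALL orders on `{0,1}^4` from the residual families**: for every product measure on `2^{Fin 4}`, if `E₅ ≥ 0` for the non-absorbing
quintuples of increasing events and `E₆ ≥ 0` for the non-absorbing sextuples, then `SahiPositive (bernoulliWeight p) n` for EVERY `n` (orders `≤ 4`: FKG and the
kernel certificates; `≥ 7`: the width collapse). [this file] -/
theorem sahiPositive_bernoulliWeight_all_fin_four_of_residual (p : Fin 4 → unitInterval)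
    (hres5 : ∀ A : Fin 5 → Set (Set (Fin 4)), (∀ i, IsUpperSet (A i)) → (∀ q : Fin 5, ∃ ω, (∀ i, i ≠ q → ω ∈ A i) ∧ ω ∉ A q) →
      0 ≤ sahiE (bernoulliWeight p) 5 (fun i => ind (A i)))
    (hres6 : ∀ A : Fin 6 → Set (Set (Fin 4)), (∀ i, IsUpperSet (A i)) → (∀ q : Fin 6, ∃ ω, (∀ i, i ≠ q → ω ∈ A i) ∧ ω ∉ A q) →
      0 ≤ sahiE (bernoulliWeight p) 6 (fun i => ind (A i))) :
    ∀ n, SahiPositive (bernoulliWeight p) n := by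
  have h5 : SahiPositive (bernoulliWeight p) 5 :=
    sahiPositive_bernoulliWeight_succ_fin_four_of_residual p 3 (sahiPositive_bernoulliWeight_four_fin_four p) hres5
  have h6 : SahiPositive (bernoulliWeight p) 6 := sahiPositive_bernoulliWeight_succ_fin_four_of_residual p 4 h5 hres6
  exact sahiPositive_bernoulliWeight_all_fin_four_of_five_six p h5 h6

end SahiHereditaryMeetAbsorption

end Summit.CriticalPhenomena.PercolationContinuityZ3.Theorems
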